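import Mathlib.Analysis.SpecialFunctions.SmoothTransition
import Mathlib.MeasureTheory.Integral.IntervalIntegral.FundThmCalculus
import Mathlib.Analysis.Calculus.Deriv.Slope
import HarnessLib

/-!
# From a distributional time-derivative inequality to monotonicity: smooth window test functions

If a continuous `F : ℝ → ℝ` satisfies `K ∫ χ ≤ ∫ (−χ′) F` for every smooth `χ` with `0 ≤ χ ≤ 1`
supported in `[t₁, t₂]`, then `K (t₂ − t₁) ≤ F(t₂) − F(t₁)` (`sub_ge_mul_of_forall_window`). This
is the standard passage from the distributional inequality `F′ ≥ K` (tested against smooth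
windows `χ_ε ↑ 1_{[t₁,t₂]}`) to the finite-difference statement, used in the tree to derive the
monotonicity of `t ↦ Var_t(μ₁, μ₂) + H t` (Bamler 2020a, Cor. 3.6/8) from a distributional form of
Bamler's distance-distortion estimate. We build the windows from `Real.smoothTransition`:

* `exists_smooth_window` — for `t₁ < t₂`, `0 < ε ≤ (t₂ − t₁)/2` a `C^∞` `χ : ℝ → [0, 1]`, `= 0`
  off `(t₁, t₂)`, `= 1` on `[t₁ + ε, t₂ − ε]`, non-decreasing left of `t₂ − ε`, non-increasing
  right of `t₁ + ε`, with `∫_{t₁}^{t₁+ε} χ′ = 1 = −∫_{t₂−ε}^{t₂} χ′`;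
* `sub_ge_mul_of_forall_window` — the conclusion above.

Everything is proved; no definitions, no named facts.

## References

* L. C. Evans, *Partial differential equations*, 2nd ed. (2010), §5.A / App. C.4 (mollified
  indicators). 
* R. H. Bamler, *Entropy and heat kernel bounds on a Ricci flow background*, arXiv:2008.07093
  (2020), proof of Cor. 3.6. [Bamler2020Entropy]
-/

noncomputable section

open Set Filter Topology MeasureTheory intervalIntegral
open scoped ContDiff Topology

namespace Literature.Analysis.Calculus

/-- **Smooth windows** `χ = ST((t − t₁)/ε) · ST((t₂ − t)/ε)` (`ST = Real.smoothTransition`): for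
`ε > 0`, `χ` is `C^∞`, takes values in `[0, 1]`, vanishes for
`t ≤ t₁` and for `t ≥ t₂`, equals `1` on `[t₁ + ε, t₂ − ε]`, agrees with the monotone
`t ↦ ST((t − t₁)/ε)` on `(−∞, t₂ − ε]` and with the antitone `t ↦ ST((t₂ − t)/ε)` on
`[t₁ + ε, ∞)`. [folklore] -/
theorem exists_smooth_window (t₁ t₂ : ℝ) {ε : ℝ} (hε : 0 < ε) :
    ∃ χ : ℝ → ℝ, ContDiff ℝ ∞ χ ∧ (∀ t, 0 ≤ χ t) ∧ (∀ t, χ t ≤ 1) ∧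
      (∀ t ≤ t₁, χ t = 0) ∧ (∀ t, t₂ ≤ t → χ t = 0) ∧
      (∀ t ∈ Icc (t₁ + ε) (t₂ - ε), χ t = 1) ∧
      (∀ t ≤ t₂ - ε, χ t = Real.smoothTransition ((t - t₁) / ε)) ∧
      (∀ t, t₁ + ε ≤ t → χ t = Real.smoothTransition ((t₂ - t) / ε)) := by
  refine ⟨fun t ↦ Real.smoothTransition ((t - t₁) / ε) * Real.smoothTransition ((t₂ - t) / ε),
    ?_, fun t ↦ mul_nonneg (Real.smoothTransition.nonneg _) (Real.smoothTransition.nonneg _),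
    fun t ↦ ?_, fun t ht ↦ ?_, fun t ht ↦ ?_, fun t ht ↦ ?_, fun t ht ↦ ?_, fun t ht ↦ ?_⟩
  · exact (Real.smoothTransition.contDiff.comp ((contDiff_id.sub contDiff_const).div_const _)).mul
      (Real.smoothTransition.contDiff.comp ((contDiff_const.sub contDiff_id).div_const _))
  · exact mul_le_one₀ (Real.smoothTransition.le_one _) (Real.smoothTransition.nonneg _)
      (Real.smoothTransition.le_one _)
  · simp only
    rw [Real.smoothTransition.zero_of_nonpos
      (div_nonpos_of_nonpos_of_nonneg (by linarith : t - t₁ ≤ 0) hε.le), zero_mul]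
  · simp only
    rw [Real.smoothTransition.zero_of_nonpos
      (div_nonpos_of_nonpos_of_nonneg (by linarith : t₂ - t ≤ 0) hε.le), mul_zero]
  · simp only
    rw [Real.smoothTransition.one_of_one_le, Real.smoothTransition.one_of_one_le, mul_one]
    · rw [le_div_iff₀ hε]; linarith [ht.2]
    · rw [le_div_iff₀ hε]; linarith [ht.1]
  · simp only
    rw [Real.smoothTransition.one_of_one_le (x := (t₂ - t) / ε), mul_one]
    rw [le_div_iff₀ hε]; linarith
  · simp only
    rw [Real.smoothTransition.one_of_one_le (x := (t - t₁) / ε), one_mul]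
    rw [le_div_iff₀ hε]; linarith

/-- **Distributional `F′ ≥ K` tested on smooth windows gives `F(t₂) − F(t₁) ≥ K (t₂ − t₁)`.** Let
`t₁ < t₂`, `F` continuous on `[t₁, t₂]`, and suppose `K ∫_{[t₁,t₂]} χ ≤ ∫_{[t₁,t₂]} (−χ′) F` for
every `C^∞` `χ : ℝ → [0, 1]` vanishing for `t ≤ t₁` and for `t ≥ t₂`. Then
`K (t₂ − t₁) ≤ F t₂ − F t₁` (windows `χ_ε ↑ 1_{[t₁,t₂]}`: `∫ χ_ε → t₂ − t₁` and
`∫ (−χ_ε′) F → F(t₂) − F(t₁)` by the continuity of `F` at the two ends). [folklore] -/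
theorem sub_ge_mul_of_forall_window {t₁ t₂ K : ℝ} (h12 : t₁ < t₂) {F : ℝ → ℝ}
    (hF : ContinuousOn F (Icc t₁ t₂))
    (h : ∀ χ : ℝ → ℝ, ContDiff ℝ ∞ χ → (∀ t, 0 ≤ χ t) → (∀ t, χ t ≤ 1) →
      (∀ t ≤ t₁, χ t = 0) → (∀ t, t₂ ≤ t → χ t = 0) →
      K * ∫ t in Icc t₁ t₂, χ t ≤ ∫ t in Icc t₁ t₂, -deriv χ t * F t) :
    K * (t₂ - t₁) ≤ F t₂ - F t₁ := by
  -- it suffices to prove `K (t₂ - t₁) ≤ F t₂ - F t₁ + η` for every `η > 0`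
  refine le_of_forall_pos_le_add fun η hη ↦ ?_
  have hη4 : 0 < η / 4 := by positivity
  -- `δ`: continuity of `F` at `t₁` and at `t₂` within `[t₁, t₂]`, and `|K| 2δ ≤ η/4`
  obtain ⟨δ₁, hδ₁, h1⟩ := Metric.continuousWithinAt_iff.1 (hF t₁ (left_mem_Icc.2 h12.le)) (η / 4) hη4
  obtain ⟨δ₂, hδ₂, h2⟩ := Metric.continuousWithinAt_iff.1 (hF t₂ (right_mem_Icc.2 h12.le)) (η / 4) hη4
  set δ : ℝ := min (min (δ₁ / 2) (δ₂ / 2)) (min ((t₂ - t₁) / 4) (η / (8 * (|K| + 1)))) with hδdef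
  have hδ0 : 0 < δ := by positivity
  have hδ₁' : δ < δ₁ := lt_of_le_of_lt ((min_le_left _ _).trans (min_le_left _ _)) (by linarith)
  have hδ₂' : δ < δ₂ := lt_of_le_of_lt ((min_le_left _ _).trans (min_le_right _ _)) (by linarith)
  have hδT4 : δ ≤ (t₂ - t₁) / 4 := (min_le_right _ _).trans (min_le_left _ _)
  have hδK : δ ≤ η / (8 * (|K| + 1)) := (min_le_right _ _).trans (min_le_right _ _)
  have hF₁ : ∀ t ∈ Icc t₁ (t₁ + δ), |F t - F t₁| ≤ η / 4 := by
    intro t ht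
    have := h1 ⟨ht.1, by linarith [ht.2]⟩
      (by rw [Real.dist_eq, abs_of_nonneg (by linarith [ht.1])]; linarith [ht.2])
    rw [Real.dist_eq] at this; exact this.le
  have hF₂ : ∀ t ∈ Icc (t₂ - δ) t₂, |F t - F t₂| ≤ η / 4 := by
    intro t ht
    have := h2 ⟨by linarith [ht.1], ht.2⟩
      (by rw [Real.dist_eq, abs_of_nonpos (by linarith [ht.2])]; linarith [ht.1])
    rw [Real.dist_eq] at this; exact this.le
  have hKδ : |K| * (2 * δ) ≤ η / 4 := by
    have hK0 : 0 ≤ |K| := abs_nonneg K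
    calc |K| * (2 * δ) ≤ |K| * (2 * (η / (8 * (|K| + 1)))) := by gcongr
      _ = (|K| / (|K| + 1)) * (η / 4) := by field_simp; ring
      _ ≤ 1 * (η / 4) := by
          gcongr
          rw [div_le_one (by positivity)]; linarith
      _ = η / 4 := one_mul _
  -- the window and the hypothesis
  obtain ⟨χ, hχs, hχ0, hχ1, hχl, hχr, hχmid, hχL, hχR⟩ := exists_smooth_window t₁ t₂ hδ0
  have key := h χ hχs hχ0 hχ1 hχl hχr
  -- times
  have hm : t₁ + δ < t₂ - δ := by linarith
  -- derivative facts
  have hχd : ∀ t, HasDerivAt χ (deriv χ t) t := fun t ↦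
    ((hχs.differentiable (by simp)).differentiableAt).hasDerivAt
  have hχ'c : Continuous (deriv χ) := hχs.continuous_deriv (by simp)
  have hψLm : Monotone fun t ↦ Real.smoothTransition ((t - t₁) / δ) := fun a b hab ↦
    Real.smoothTransition.monotone (div_le_div_of_nonneg_right (by linarith) hδ0.le)
  have hψRa : Antitone fun t ↦ Real.smoothTransition ((t₂ - t) / δ) := fun a b hab ↦
    Real.smoothTransition.monotone (div_le_div_of_nonneg_right (by linarith) hδ0.le)
  have hχ'L : ∀ t < t₂ - δ, 0 ≤ deriv χ t := by
    intro t ht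
    have hev : χ =ᶠ[𝓝 t] fun t ↦ Real.smoothTransition ((t - t₁) / δ) := by
      filter_upwards [Iio_mem_nhds ht] with s hs using hχL s hs.le
    rw [hev.deriv_eq]; exact hψLm.deriv_nonneg
  have hχ'R : ∀ t, t₁ + δ < t → deriv χ t ≤ 0 := by
    intro t ht
    have hev : χ =ᶠ[𝓝 t] fun t ↦ Real.smoothTransition ((t₂ - t) / δ) := by
      filter_upwards [Ioi_mem_nhds ht] with s hs using hχR s hs.le
    rw [hev.deriv_eq]
    have := hψRa.neg.deriv_nonneg (x := t)
    have e : deriv (-fun t ↦ Real.smoothTransition ((t₂ - t) / δ)) t =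
        -deriv (fun t ↦ Real.smoothTransition ((t₂ - t) / δ)) t := deriv.neg
    rw [show (fun x ↦ -Real.smoothTransition ((t₂ - x) / δ)) =
      -fun t ↦ Real.smoothTransition ((t₂ - t) / δ) from rfl, e] at this
    linarith
  -- `χ′ = 0` on the closed middle (endpoints by continuity of `χ′`)
  have hχ'mid : ∀ t ∈ Icc (t₁ + δ) (t₂ - δ), deriv χ t = 0 := by
    intro t ht
    rcases eq_or_lt_of_le ht.1 with h₁ | h₁
    · -- `t = t₁ + δ`: `χ′ ≥ 0` there, `≤ 0` to the right
      subst h₁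
      refine le_antisymm ?_ (hχ'L _ hm)
      have hT : Tendsto (deriv χ) (𝓝[>] (t₁ + δ)) (𝓝 (deriv χ (t₁ + δ))) :=
        hχ'c.continuousAt.tendsto.mono_left nhdsWithin_le_nhds
      exact le_of_tendsto hT (eventually_nhdsWithin_of_forall fun s hs ↦ hχ'R s hs)
    rcases eq_or_lt_of_le ht.2 with h₂ | h₂
    · -- `t = t₂ - δ`
      refine le_antisymm (hχ'R _ h₁) ?_
      have hT : Tendsto (deriv χ) (𝓝[<] t) (𝓝 (deriv χ t)) :=
        hχ'c.continuousAt.tendsto.mono_left nhdsWithin_le_nhds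
      exact ge_of_tendsto hT (eventually_nhdsWithin_of_forall fun s hs ↦ hχ'L s (h₂ ▸ hs))
    · exact le_antisymm (hχ'R _ h₁) (hχ'L _ h₂)
  -- interval integrability helpers
  have hIχ : ∀ a b, IntervalIntegrable χ volume a b := fun a b ↦ hχs.continuous.intervalIntegrable a b
  have hIχ' : ∀ a b, IntervalIntegrable (deriv χ) volume a b := fun a b ↦ hχ'c.intervalIntegrable a b
  have hIF : ∀ {a b : ℝ}, a ≤ b → Icc a b ⊆ Icc t₁ t₂ →
      IntervalIntegrable (fun t ↦ -deriv χ t * F t) volume a b := fun hab hsub ↦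
    ((hχ'c.neg.continuousOn).mul (hF.mono hsub)).intervalIntegrable_of_Icc hab
  have hsub₁ : Icc t₁ (t₁ + δ) ⊆ Icc t₁ t₂ := Icc_subset_Icc le_rfl (by linarith)
  have hsub₂ : Icc (t₁ + δ) (t₂ - δ) ⊆ Icc t₁ t₂ := Icc_subset_Icc (by linarith) (by linarith)
  have hsub₃ : Icc (t₂ - δ) t₂ ⊆ Icc t₁ t₂ := Icc_subset_Icc (by linarith) le_rfl
  have hsub₁₂ : Icc t₁ (t₂ - δ) ⊆ Icc t₁ t₂ := Icc_subset_Icc le_rfl (by linarith)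
  -- set integrals over `Icc` as interval integrals
  have hIcc : ∀ f : ℝ → ℝ, ∫ t in Icc t₁ t₂, f t = ∫ t in t₁..t₂, f t := fun f ↦ by
    rw [integral_Icc_eq_integral_Ioc, intervalIntegral.integral_of_le h12.le]
  rw [hIcc, hIcc] at key
  -- (A) `∫ χ ≥ t₂ - t₁ - 2δ`
  have hA : t₂ - t₁ - 2 * δ ≤ ∫ t in t₁..t₂, χ t := by
    rw [← integral_add_adjacent_intervals (hIχ t₁ (t₁ + δ)) (hIχ (t₁ + δ) t₂),
      ← integral_add_adjacent_intervals (hIχ (t₁ + δ) (t₂ - δ)) (hIχ (t₂ - δ) t₂)]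
    have i1 : 0 ≤ ∫ t in t₁..(t₁ + δ), χ t := intervalIntegral.integral_nonneg (by linarith) fun t _ ↦ hχ0 t
    have i3 : 0 ≤ ∫ t in (t₂ - δ)..t₂, χ t := intervalIntegral.integral_nonneg (by linarith) fun t _ ↦ hχ0 t
    have i2 : ∫ t in (t₁ + δ)..(t₂ - δ), χ t = t₂ - δ - (t₁ + δ) := by
      rw [intervalIntegral.integral_congr (g := fun _ ↦ (1 : ℝ)) (fun t ht ↦ ?_)]
      · simp
      · rw [uIcc_of_le hm.le] at ht; exact hχmid t ht
    linarith
  -- (B) `∫ (−χ′) F ≤ F t₂ − F t₁ + η/2`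
  have hB : ∫ t in t₁..t₂, -deriv χ t * F t ≤ F t₂ - F t₁ + η / 2 := by
    rw [← integral_add_adjacent_intervals (hIF (by linarith) hsub₁) (hIF (by linarith) (Icc_subset_Icc (by linarith) le_rfl)),
      ← integral_add_adjacent_intervals (hIF hm.le hsub₂) (hIF (by linarith) hsub₃)]
    -- the middle vanishes
    have i2 : ∫ t in (t₁ + δ)..(t₂ - δ), -deriv χ t * F t = 0 := by
      rw [intervalIntegral.integral_congr (g := fun _ ↦ (0 : ℝ)) (fun t ht ↦ ?_)]
      · simp
      · rw [uIcc_of_le hm.le] at ht; simp [hχ'mid t ht]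
    -- the rise: `∫_{t₁}^{t₁+δ} χ′ = 1`
    have hFTC₁ : ∫ t in t₁..(t₁ + δ), deriv χ t = 1 := by
      rw [integral_eq_sub_of_hasDerivAt (fun t _ ↦ hχd t) (hIχ' _ _), hχl t₁ le_rfl,
        hχmid (t₁ + δ) ⟨le_rfl, hm.le⟩]; ring
    have i1 : ∫ t in t₁..(t₁ + δ), -deriv χ t * F t ≤ -F t₁ + η / 4 := by
      have e : (fun t ↦ -deriv χ t * F t) = fun t ↦ -(deriv χ t * (F t - F t₁)) + (-F t₁) * deriv χ t := by
        funext t; ring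
      rw [e, intervalIntegral.integral_add ?_ ((hIχ' _ _).const_mul _), intervalIntegral.integral_neg,
        intervalIntegral.integral_const_mul, hFTC₁]
      · have hb : ‖∫ t in t₁..(t₁ + δ), deriv χ t * (F t - F t₁)‖ ≤ ∫ t in t₁..(t₁ + δ), (η / 4) * deriv χ t := by
          refine norm_integral_le_of_norm_le (by linarith) (Eventually.of_forall fun t ht ↦ ?_)
            ((hIχ' _ _).const_mul _)
          have hpos : 0 ≤ deriv χ t := hχ'L t (by linarith [ht.2])
          rw [norm_mul, Real.norm_eq_abs, Real.norm_eq_abs, abs_of_nonneg hpos, mul_comm]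
          exact mul_le_mul_of_nonneg_right (hF₁ t ⟨ht.1.le, ht.2⟩) hpos
        rw [intervalIntegral.integral_const_mul, hFTC₁, mul_one, Real.norm_eq_abs] at hb
        have := neg_abs_le (∫ t in t₁..(t₁ + δ), deriv χ t * (F t - F t₁))
        linarith [hb]
      · refine ((hIχ' _ _).mul_continuousOn ?_).neg
        rw [uIcc_of_le (by linarith)]
        exact (hF.mono hsub₁).sub continuousOn_const
    -- the fall: `∫_{t₂−δ}^{t₂} χ′ = −1`
    have hFTC₃ : ∫ t in (t₂ - δ)..t₂, deriv χ t = -1 := by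
      rw [integral_eq_sub_of_hasDerivAt (fun t _ ↦ hχd t) (hIχ' _ _), hχr t₂ le_rfl,
        hχmid (t₂ - δ) ⟨hm.le, le_rfl⟩]; ring
    have i3 : ∫ t in (t₂ - δ)..t₂, -deriv χ t * F t ≤ F t₂ + η / 4 := by
      have e : (fun t ↦ -deriv χ t * F t) = fun t ↦ -(deriv χ t * (F t - F t₂)) + (-F t₂) * deriv χ t := by
        funext t; ring
      rw [e, intervalIntegral.integral_add ?_ ((hIχ' _ _).const_mul _), intervalIntegral.integral_neg,
        intervalIntegral.integral_const_mul, hFTC₃]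
      · have hb : ‖∫ t in (t₂ - δ)..t₂, deriv χ t * (F t - F t₂)‖ ≤ ∫ t in (t₂ - δ)..t₂, (η / 4) * (-deriv χ t) := by
          refine norm_integral_le_of_norm_le (by linarith) (Eventually.of_forall fun t ht ↦ ?_)
            ((hIχ' _ _).neg.const_mul _)
          have hneg : deriv χ t ≤ 0 := hχ'R t (by linarith [ht.1])
          rw [norm_mul, Real.norm_eq_abs, Real.norm_eq_abs, abs_of_nonpos hneg, mul_comm]
          exact mul_le_mul_of_nonneg_right (hF₂ t ⟨ht.1.le, ht.2⟩) (by linarith)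
        rw [intervalIntegral.integral_const_mul, intervalIntegral.integral_neg, hFTC₃, Real.norm_eq_abs,
          neg_neg, mul_one] at hb
        have := neg_abs_le (∫ t in (t₂ - δ)..t₂, deriv χ t * (F t - F t₂))
        linarith [hb]
      · refine ((hIχ' _ _).mul_continuousOn ?_).neg
        rw [uIcc_of_le (by linarith)]
        exact (hF.mono hsub₃).sub continuousOn_const
    linarith
  -- (C) combine
  have hχle : ∫ t in t₁..t₂, χ t ≤ t₂ - t₁ := by
    have := intervalIntegral.integral_mono_on h12.le (hIχ _ _) intervalIntegrable_const
      (fun t _ ↦ hχ1 t) (g := fun _ ↦ (1 : ℝ))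
    simpa using this
  have hC : K * (t₂ - t₁) ≤ K * (∫ t in t₁..t₂, χ t) + η / 4 := by
    have habs : |(t₂ - t₁) - ∫ t in t₁..t₂, χ t| ≤ 2 * δ := by
      rw [abs_le]; constructor <;> linarith
    have : K * (t₂ - t₁) - K * (∫ t in t₁..t₂, χ t) ≤ |K| * (2 * δ) := by
      rw [← mul_sub]
      exact (le_abs_self _).trans (by rw [abs_mul]; exact mul_le_mul_of_nonneg_left habs (abs_nonneg _))
    linarith
  linarith

end Literature.Analysis.Calculus

end
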